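import Summits.Parity.GeneralizedHardyLittlewood.Theorems.GreenTaoLevelTwoGITwoCyclicInverseAveraging
import Mathlib.Analysis.SpecialFunctions.Complex.CircleAddChar
import Literature.NumberTheory.Sieve.LinearEquationsInPrimesFourierU2

/-!
# Route `GreenTaoLevelTwo`, crux `GITwo` (stmt-Parity-21275), line `birth`, stub `stub_cyclicInverse`:
# spreading the derivative correlation over translates (GT08a §9 Step 3, "by Lemma (avg-1) … and
# hence by the triangle inequality")

Fifty-second helper file toward the XL stub `stub_cyclicInverse` (B. Green, T. Tao, *An inverse
theorem for the Gowers `U³(G)` norm*, arXiv:math/0503014, Thm. 68 = PEMS 51 (2008) Thm. 12.8).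
Block C13, §9 Step 3, the display after the descent to `B₄`: the global `x`-sum is an average of
sums over translates `y + B₄` (`sum_sum_translate_eq`, arXiv Lemma 20 as an identity), and after
the triangle inequality in `y` the phases `e(−μ(h)y)` are absorbed into the weight of `h`:
from `κ N #B₄ ≤ Σ_{h∈B₄} |Σ_x c₂(x+h) c₃(x) e(−μ(h)x)|` one gets a family of `1`-bounded weights
`b_y(h)` with
`κ N #B₄² ≤ Σ_y |Σ_{h∈B₄} b_y(h) Σ_{x∈B₄} c₂(x+y+h) c₃(x+y) e(−μ(h)x)|`.

* `exists_translate_family_ge` — the statement above (for an arbitrary finset `B₄`).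

References: [GreenTao2008U3Inverse] arXiv:math/0503014, §9 Step 3.
-/

noncomputable section

namespace Summit.Parity.GeneralizedHardyLittlewood.GreenTaoLevelTwoGITwoCyclicInverse

open Finset ZMod
open scoped ComplexConjugate

open Literature.NumberTheory.Sieve

variable {N : ℕ} [NeZero N]

/-- **GT08a §9 Step 3, spreading over translates.**  For a finset `B₄ ⊆ ℤ/Nℤ`, `μ`, weights
`c₂, c₃` and `κ` with `κ N #B₄ ≤ Σ_{h∈B₄} |Σ_x c₂(x+h) c₃(x) e(−μ(h)x/N)|`, there is a family of
weights `b : ℤ/Nℤ → ℤ/Nℤ → ℂ`, `‖b y h‖ ≤ 1`, with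
`κ N #B₄² ≤ Σ_y |Σ_{h∈B₄} b y h · Σ_{x∈B₄} c₂(x+y+h) c₃(x+y) e(−μ(h)x/N)|`.
[cite: GreenTao2008U3Inverse, §9 Step 3] -/
theorem exists_translate_family_ge (B₄ : Finset (ZMod N)) (μ : ZMod N → ZMod N)
    (c₂ c₃ : ZMod N → ℂ) {κ : ℝ}
    (hbig : κ * N * #B₄ ≤ ∑ h ∈ B₄, ‖∑ x : ZMod N, c₂ (x + h) * c₃ x * stdAddChar (-(μ h * x))‖) :
    ∃ b : ZMod N → ZMod N → ℂ, (∀ y h, ‖b y h‖ ≤ 1) ∧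
      κ * N * (#B₄ : ℝ) ^ 2 ≤ ∑ y : ZMod N, ‖∑ h ∈ B₄, b y h *
        ∑ x ∈ B₄, c₂ (x + y + h) * c₃ (x + y) * stdAddChar (-(μ h * x))‖ := by
  classical
  -- the phases making each `I(h)` real
  set I : ZMod N → ℂ := fun h => ∑ x : ZMod N, c₂ (x + h) * c₃ x * stdAddChar (-(μ h * x)) with hI
  set b₁ : ZMod N → ℂ := fun h => if I h = 0 then 0 else conj (I h) / (‖I h‖ : ℂ) with hb₁
  have hb₁1 : ∀ h, ‖b₁ h‖ ≤ 1 := fun h => by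
    rw [hb₁]; simp only
    split_ifs with h0
    · simp
    · rw [norm_div, Complex.norm_conj, Complex.norm_real, Real.norm_eq_abs, abs_of_nonneg
        (norm_nonneg _), div_self (norm_ne_zero_iff.mpr h0)]
  have hb₁I : ∀ h, b₁ h * I h = (‖I h‖ : ℂ) := fun h => by
    rw [hb₁]; simp only
    split_ifs with h0
    · rw [h0]; simp
    · have hne : (‖I h‖ : ℂ) ≠ 0 := by exact_mod_cast norm_ne_zero_iff.mpr h0
      rw [div_mul_eq_mul_div, div_eq_iff hne, mul_comm (conj (I h)), Complex.mul_conj,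
        Complex.normSq_eq_norm_sq]
      push_cast; ring
  -- the family `b y h = b₁ h e(−μ(h)y)`
  refine ⟨fun y h => b₁ h * stdAddChar (-(μ h * y)), fun y h => by
    rw [norm_mul, norm_stdAddChar, mul_one]; exact hb₁1 h, ?_⟩
  -- `g(x) = Σ_h b₁ h c₂(x+h) c₃(x) e(−μ(h)x)` has `Σ_x g(x) = Σ_h ‖I h‖`
  set g : ZMod N → ℂ := fun x => ∑ h ∈ B₄, b₁ h * (c₂ (x + h) * c₃ x * stdAddChar (-(μ h * x)))
    with hg
  have hsumg : ∑ x : ZMod N, g x = ∑ h ∈ B₄, (‖I h‖ : ℂ) := by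
    rw [hg]; simp only
    rw [Finset.sum_comm]
    refine sum_congr rfl fun h _ => ?_
    rw [← mul_sum, hb₁I]
  have hnormg : κ * N * #B₄ ≤ ‖∑ x : ZMod N, g x‖ := by
    rw [hsumg]
    have : ((∑ h ∈ B₄, ‖I h‖ : ℝ) : ℂ) = ∑ h ∈ B₄, (‖I h‖ : ℂ) := by push_cast; rfl
    rw [← this, Complex.norm_real, Real.norm_eq_abs,
      abs_of_nonneg (sum_nonneg fun _ _ => norm_nonneg _)]
    exact hbig
  -- spread over translates: `#B₄ Σ_x g(x) = Σ_y Σ_{x∈B₄} g(x+y)`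
  have hspread : (#B₄ : ℝ) * ‖∑ x : ZMod N, g x‖ ≤ ∑ y : ZMod N, ‖∑ x ∈ B₄, g (x + y)‖ := by
    have h1 : ((#B₄ : ℂ)) * ∑ x : ZMod N, g x = ∑ y : ZMod N, ∑ x ∈ B₄, g (x + y) := by
      rw [sum_sum_translate_eq, nsmul_eq_mul]
    calc (#B₄ : ℝ) * ‖∑ x : ZMod N, g x‖ = ‖((#B₄ : ℂ)) * ∑ x : ZMod N, g x‖ := by
          rw [norm_mul, Complex.norm_natCast]
      _ = ‖∑ y : ZMod N, ∑ x ∈ B₄, g (x + y)‖ := by rw [h1]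
      _ ≤ _ := norm_sum_le _ _
  -- rewrite each translate sum
  have hrew : ∀ y : ZMod N, ∑ x ∈ B₄, g (x + y) = ∑ h ∈ B₄, (b₁ h * stdAddChar (-(μ h * y))) *
      ∑ x ∈ B₄, c₂ (x + y + h) * c₃ (x + y) * stdAddChar (-(μ h * x)) := by
    intro y
    rw [hg]; simp only
    rw [Finset.sum_comm]
    refine sum_congr rfl fun h _ => ?_
    rw [mul_sum]
    refine sum_congr rfl fun x _ => ?_
    have : (stdAddChar (-(μ h * (x + y))) : ℂ) = stdAddChar (-(μ h * y)) * stdAddChar (-(μ h * x)) := by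
      rw [← AddChar.map_add_eq_mul]; congr 1; ring
    rw [this]; ring
  calc κ * N * (#B₄ : ℝ) ^ 2 = #B₄ * (κ * N * #B₄) := by ring
    _ ≤ #B₄ * ‖∑ x : ZMod N, g x‖ := mul_le_mul_of_nonneg_left hnormg (Nat.cast_nonneg _)
    _ ≤ ∑ y : ZMod N, ‖∑ x ∈ B₄, g (x + y)‖ := hspread
    _ = _ := sum_congr rfl fun y _ => by rw [hrew y]

end Summit.Parity.GeneralizedHardyLittlewood.GreenTaoLevelTwoGITwoCyclicInverse
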